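/-
Copyright (c) 2026 the pub-hodgecm-mathlib formalisation cell (harness21).  Prover seat hodgecm-mathlib-B-p10 (g25), brick (E4″) of the κ = −1 closer chain
(:1269 `stub_irredGValueNeg`; design pen B-p14 (g31), LEAD T8-127 (1), architect A-p06 (g26)), 2026-09-01.
-/
import Literature.NumberTheory.Automorphic.UnitaryThreeAnisotropicNormalForm            -- ★ B-p14 (d1) p841988: `map_mul_self_eq_one_of_mulVec_eq_smul`, `exists_coe_eq_smul_one`
import Literature.NumberTheory.Automorphic.UnitaryThreeAnisotropicStabilizerCoordinates  -- ★ A-p13 FILE 1: `stabilizer_r_eq`; brings ★ Bounds (`stabilizer_valuation_bounds`)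
import Literature.NumberTheory.Automorphic.UnitaryThreeDoubleCosetsAnisotropicStabilizer -- ★ (C′) p841385: `exists_coe_eq_of_mulVec_anisoVec_eq`
import Literature.NumberTheory.Automorphic.AnisotropicUnitaryGroupCompact                -- ★ topology kit: `isCompact_setOf_v_apply_le_exp`, `continuous_of_forall_v_eq`
import Literature.NumberTheory.Automorphic.UnitaryGroupOfFormAdelicTopology              -- ★ `isClosed_unitaryGroupOfForm`
import Literature.NumberTheory.Automorphic.UnitaryThreeAnisotropicFixedPointCriterion    -- ★ B-p14 (ii-a): `shape_mulVec_anisoVec`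
import Literature.NumberTheory.Automorphic.UnitOrbitalIntegralUnfoldingAnisotropic       -- ★ B-p14 (F2′): `mem_stabilizer_anisoVec_iff` (the `↥U`-action on vectors)
import HarnessLib

/-!
# The stabiliser `Stab(w₀) ≤ U(2,1)(K)` of the anisotropic vector is COMPACT, and so is the centraliser of any type-(2) element of it
# (Flicker 1998, Prop. 4 p. 82 «`H′ = U(1) × U(2)` anisotropic»; Rogawski 1990 §3.6: elliptic tori are compact)

Topic `NumberTheory/Automorphic`; namespace `Literature.NumberTheory.Automorphic.UnitaryGroup`.  THEOREMS ONLY (no `def`, no instance, no notation, no named fact, no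
`sorry`); kernel lane; count-neutral.  Cell `pub/hodgecm-mathlib`, crux H413, line «N7nsCount» ED. 1.5, value stub `stub_irredGValueNeg` (:1269, κ = −1): brick **(E4″)** =
link L1b of B-p14 (g31)'s closer chain (the `[CompactSpace Z_{G′_v}(δ)]` premise of the socket ★ `classOrbitalIntegral_indicator_complex_cmLocalIntegralLevel_eq_natCard_fixedBy`),
for the κ = −1 normal form ★ (d1) `exists_smul_one_inv_mul_conj_mem_stabilizer` (`t = z·(g t′ g⁻¹)`, `z` central, `t′ ∈ Stab(w₀)`).  HONEST LABEL: HC_CM is proved only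
modulo the printed citations until rung 0 closes; topology for ONE premise of ONE value stub of #103-ns.

SETTING (abstract, as LAYER B′ + ★ `AnisotropicUnitaryGroupCompact`): `K` with `Valued K ℤᵐ⁰` and COMPACT valuation ring, `hd : LocalConjDatum σ ϖ`, `J = Φ₃`,
`U = U(σ, Φ₃)(K) ≤ GL₃(K)` with the subspace topology, `w₀ = ![1, 0, −2ϖ]`, `S = Stab(w₀)`.
* §1 **`isCompact_stabilizer_anisoVec`** — `S` is compact: every `h ∈ S` is `M(b,q,r,s)` (★ (C′)) with `|s| = 1`, `|q|, |r| ≤ 1`, `|1 + 4ϖb| = 1` (★ Bounds), so all entries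
  of `h` AND of `h⁻¹ ∈ S` have `v ≤ exp 1` (`v_stabilizerShape_apply_le`); `S` is closed; ★ `isCompact_setOf_v_apply_le_exp`.  (Flicker's `H′ = Stab(ν₀) ≅ U(1) × U(2)` with
  `U(2)` ANISOTROPIC — cf. ★ `isCompact_unitaryGroupOfForm_of_anisotropic`; here read directly off the coordinates.)
* §2 **type (2) ⇒ `1` is not an eigenvalue off the line**: `det_typeTwo_ne_zero` (`q_t r_t − b_t(s_t − 1) ≠ 0` from the sizes `|q_t| = |r_t| = |ϖ|^N`,
  `|A_t − s_t| ≤ |ϖ|^{N+1}` by PARITY: `|4ϖ q_t r_t| = |ϖ|^{2N+1}` is odd, `|(A_t − 1)(s_t − 1)|` is a square or `≤ |ϖ|^{2N+2}`) and `mulVec_eq_self_of_det_ne_zero`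
  (`t x = x ⇒ x ∈ K w₀`).
* §3 **`compactSpace_centralizer_of_mem_stabilizer`** — for `t ∈ S` with that determinant non-zero, `Z_U(t)` is compact: `z ∈ Z_U(t) ⇒ z w₀ = c w₀` with `σc·c = 1`
  (★ (d1)), `c⁻¹z ∈ S`, so `z` and `z⁻¹` have entries `v ≤ exp 1`; closed ⇒ compact; `…_of_typeTwo` with the ★ Bounds sizes.
* §4 TRANSPORTS for the closer (generic topological groups): `centralizer_singleton_mul_eq_of_forall_commute` (central factor), `compactSpace_centralizer_conj_iff`
  (conjugation), `compactSpace_centralizer_of_continuousMulEquiv` (a `≃ₜ*`, e.g. the frame `G′_v ≃ₜ* U_w` of ★ L2).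

## References
* [Flicker1998UnitaryFL] Y. Z. Flicker, *Elementary proof of the fundamental lemma for a unitary group*, Canad. J. Math. 50 (1998), Prop. 4 pp. 80–82, Prop. 16 p. 96.
* [Rogawski1990] J. D. Rogawski, *Automorphic Representations of Unitary Groups in Three Variables* (1990), §3.6 pp. 31–32.
* [PlatonovRapinchuk1994] V. Platonov, A. Rapinchuk, *Algebraic Groups and Number Theory* (1994), §3.1 Thm. 3.1 (anisotropic ⟺ compact over local fields).
-/

set_option autoImplicit false

noncomputable section

open scoped MatrixGroups WithZero Valued
open Matrix Topology

namespace Literature.NumberTheory.Automorphic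

namespace UnitaryGroup

open Literature.NumberTheory.Automorphic.HermitianLattice

variable {K : Type*} [Field K] [Valued K ℤᵐ⁰] {ϖ : K}
  (σ : K →+* K) {J : Matrix (Fin 3) (Fin 3) K} (hJ : J = (StdForm.antidiagonal 3).over K)

/-! ## §1 The stabiliser of the anisotropic vector is compact -/

section Stabilizer

/-- Entry bound for the stabiliser shape: if `|1 + 4ϖb| = 1`, `|q|, |r| ≤ 1`, `|s| = 1` then every entry of `M(b,q,r,s)` has `v ≤ exp 1` (`|b| ≤ |ϖ|⁻¹`).
[cite: Flicker1998UnitaryFL, Prop. 4 p. 82] -/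
theorem v_stabilizerShape_apply_le (hd : LocalConjDatum σ ϖ) {b q r s : K} (hA : Valued.v (1 + 4 * ϖ * b) = 1) (hq : Valued.v q ≤ 1)
    (hr : Valued.v r ≤ 1) (hs : Valued.v s = 1) (i j : Fin 3) :
    Valued.v ((!![1 + 2 * ϖ * b, q, b; 2 * ϖ * r, s, r; 4 * ϖ ^ 2 * b, 2 * ϖ * q, 1 + 2 * ϖ * b] : Matrix (Fin 3) (Fin 3) K) i j) ≤
      WithZero.exp (1 : ℤ) := by
  have h2 : Valued.v (2 : K) = 1 := hd.v2
  have h4 : Valued.v (4 : K) = 1 := by rw [show (4 : K) = 2 * 2 by norm_num, map_mul, h2, one_mul]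
  have hϖ : Valued.v ϖ = WithZero.exp (-1 : ℤ) := hd.vϖ
  have h01 : (1 : ℤᵐ⁰) ≤ WithZero.exp (1 : ℤ) := by rw [← WithZero.exp_zero, WithZero.exp_le_exp]; norm_num
  -- `|4ϖb| ≤ 1`, hence `|ϖ b| ≤ 1` and `|b| ≤ exp 1`
  have hϖb : Valued.v (ϖ * b) ≤ 1 := by
    have h : Valued.v (4 * ϖ * b) ≤ 1 := by
      have e : 4 * ϖ * b = (1 + 4 * ϖ * b) + -1 := by ring
      rw [e]
      exact Valuation.map_add_le _ hA.le (by rw [Valuation.map_neg, Valuation.map_one])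
    rwa [mul_assoc, map_mul, h4, one_mul] at h
  have hb : Valued.v b ≤ WithZero.exp (1 : ℤ) := by
    rw [map_mul, hϖ] at hϖb
    have h : WithZero.exp (1 : ℤ) * (WithZero.exp (-1 : ℤ) * Valued.v b) ≤ WithZero.exp (1 : ℤ) * 1 := mul_le_mul_right hϖb _
    rwa [← mul_assoc, ← WithZero.exp_add, show (1 : ℤ) + -1 = 0 by norm_num, WithZero.exp_zero, one_mul, mul_one] at h
  have h2ϖb : Valued.v (2 * ϖ * b) ≤ 1 := by rw [mul_assoc, map_mul, h2, one_mul]; exact hϖb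
  have hdiag : Valued.v (1 + 2 * ϖ * b) ≤ WithZero.exp (1 : ℤ) := (Valuation.map_add_le _ (by rw [Valuation.map_one]) h2ϖb).trans h01
  have hϖ1 : Valued.v ϖ ≤ 1 := by rw [hϖ, ← WithZero.exp_zero, WithZero.exp_le_exp]; norm_num
  have h2ϖr : Valued.v (2 * ϖ * r) ≤ WithZero.exp (1 : ℤ) := by
    rw [map_mul, map_mul, h2, one_mul]; exact (mul_le_one' hϖ1 hr).trans h01
  have h2ϖq : Valued.v (2 * ϖ * q) ≤ WithZero.exp (1 : ℤ) := by
    rw [map_mul, map_mul, h2, one_mul]; exact (mul_le_one' hϖ1 hq).trans h01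
  have h4ϖϖb : Valued.v (4 * ϖ ^ 2 * b) ≤ WithZero.exp (1 : ℤ) := by
    rw [show 4 * ϖ ^ 2 * b = (4 * ϖ) * (ϖ * b) by ring, map_mul, map_mul, h4, one_mul]
    exact (mul_le_one' hϖ1 hϖb).trans h01
  fin_cases i <;> fin_cases j <;>
    [exact hdiag; exact hq.trans h01; exact hb; exact h2ϖr; exact hs.le.trans h01; exact hr.trans h01; exact h4ϖϖb; exact h2ϖq; exact hdiag]

include hJ in
/-- **Every element of `Stab(w₀)` and its inverse have all entries of valuation `≤ exp 1`.** [cite: Flicker1998UnitaryFL, Prop. 4 p. 82] -/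
theorem v_apply_le_of_mulVec_anisoVec_eq (hd : LocalConjDatum σ ϖ) {h : ↥(unitaryGroupOfForm σ J)}
    (hw : ((h : GL (Fin 3) K) : Matrix (Fin 3) (Fin 3) K) *ᵥ ![1, 0, -(2 * ϖ)] = ![1, 0, -(2 * ϖ)]) (i j : Fin 3) :
    Valued.v (((h : GL (Fin 3) K) : Matrix (Fin 3) (Fin 3) K) i j) ≤ WithZero.exp (1 : ℤ) := by
  obtain ⟨b, q, r, s, hh⟩ := exists_coe_eq_of_mulVec_anisoVec_eq σ hJ hd hw
  obtain ⟨hs, hq, hA, hr⟩ := stabilizer_valuation_bounds σ hJ hd hh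
  rw [hh]
  exact v_stabilizerShape_apply_le σ hd hA hq hr hs i j

omit [Valued K ℤᵐ⁰] in
/-- If `h w₀ = w₀` then `h⁻¹ w₀ = w₀` (the stabiliser is a subgroup). [cite: Flicker1998UnitaryFL, Prop. 4 p. 82] -/
theorem inv_mulVec_eq_of_mulVec_eq (h : GL (Fin 3) K) {w : Fin 3 → K} (hw : (h : Matrix (Fin 3) (Fin 3) K) *ᵥ w = w) :
    ((h⁻¹ : GL (Fin 3) K) : Matrix (Fin 3) (Fin 3) K) *ᵥ w = w := by
  have := congrArg (fun x => ((h⁻¹ : GL (Fin 3) K) : Matrix (Fin 3) (Fin 3) K) *ᵥ x) hw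
  simp only [Matrix.mulVec_mulVec, ← Units.val_mul, inv_mul_cancel, Units.val_one, Matrix.one_mulVec] at this
  exact this.symm

include hJ in
/-- **`Stab(w₀)` IS COMPACT** (as a subset of `U = U(σ, Φ₃)(K)`, compact valuation ring): it is closed, and inside the compact set of `g ∈ GL₃(K)` whose entries and whose
inverse's entries have `v ≤ exp 1` (★ `isCompact_setOf_v_apply_le_exp`). [cite: Flicker1998UnitaryFL, Prop. 4 p. 82] [cite: PlatonovRapinchuk1994, §3.1 Thm. 3.1] -/
theorem isCompact_stabilizer_anisoVec [CompactSpace 𝒪[K]] (hd : LocalConjDatum σ ϖ) :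
    IsCompact ((MulAction.stabilizer (↥(unitaryGroupOfForm σ J)) (![1, 0, -(2 * ϖ)] : Fin 3 → K) :
      Subgroup ↥(unitaryGroupOfForm σ J)) : Set ↥(unitaryGroupOfForm σ J)) := by
  have hσc : Continuous σ := continuous_of_forall_v_eq hd.vσ
  have hUc : IsClosed ((unitaryGroupOfForm σ J : Subgroup (GL (Fin 3) K)) : Set (GL (Fin 3) K)) := isClosed_unitaryGroupOfForm hσc J
  -- the compact box in `GL₃(K)` and the closed condition `g w₀ = w₀`
  have hbox := isCompact_setOf_v_apply_le_exp (n := Fin 3) hd.vϖ 1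
  have hfix : IsClosed {g : GL (Fin 3) K | (g : Matrix (Fin 3) (Fin 3) K) *ᵥ (![1, 0, -(2 * ϖ)] : Fin 3 → K) = ![1, 0, -(2 * ϖ)]} :=
    isClosed_eq (Units.continuous_val.matrix_mulVec continuous_const) continuous_const
  have hC : IsCompact ({g : GL (Fin 3) K | (∀ i j, Valued.v ((g : Matrix (Fin 3) (Fin 3) K) i j) ≤ WithZero.exp ((1 : ℕ) : ℤ)) ∧
      ∀ i j, Valued.v (((g⁻¹ : GL (Fin 3) K) : Matrix (Fin 3) (Fin 3) K) i j) ≤ WithZero.exp ((1 : ℕ) : ℤ)} ∩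
      (((unitaryGroupOfForm σ J : Subgroup (GL (Fin 3) K)) : Set (GL (Fin 3) K)) ∩
        {g : GL (Fin 3) K | (g : Matrix (Fin 3) (Fin 3) K) *ᵥ (![1, 0, -(2 * ϖ)] : Fin 3 → K) = ![1, 0, -(2 * ϖ)]})) :=
    hbox.inter_right (hUc.inter hfix)
  -- pull back along the closed embedding `↥U → GL₃(K)`
  have hemb : Topology.IsClosedEmbedding (Subtype.val : ↥(unitaryGroupOfForm σ J) → GL (Fin 3) K) := hUc.isClosedEmbedding_subtypeVal
  refine (hemb.isCompact_preimage hC).of_isClosed_subset ?_ ?_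
  · have hset : ((MulAction.stabilizer (↥(unitaryGroupOfForm σ J)) (![1, 0, -(2 * ϖ)] : Fin 3 → K) :
        Subgroup ↥(unitaryGroupOfForm σ J)) : Set ↥(unitaryGroupOfForm σ J)) =
        Subtype.val ⁻¹' {g : GL (Fin 3) K | (g : Matrix (Fin 3) (Fin 3) K) *ᵥ (![1, 0, -(2 * ϖ)] : Fin 3 → K) = ![1, 0, -(2 * ϖ)]} := by
      ext h; exact mem_stabilizer_anisoVec_iff σ _ h
    rw [hset]
    exact hfix.preimage continuous_subtype_val
  · intro h hh
    have hw : ((h : GL (Fin 3) K) : Matrix (Fin 3) (Fin 3) K) *ᵥ ![1, 0, -(2 * ϖ)] = ![1, 0, -(2 * ϖ)] := (mem_stabilizer_anisoVec_iff σ _ h).1 hh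
    have hw' : (((h⁻¹ : ↥(unitaryGroupOfForm σ J)) : GL (Fin 3) K) : Matrix (Fin 3) (Fin 3) K) *ᵥ ![1, 0, -(2 * ϖ)] = ![1, 0, -(2 * ϖ)] := by
      rw [Subgroup.coe_inv]; exact inv_mulVec_eq_of_mulVec_eq _ hw
    refine ⟨⟨fun i j => ?_, fun i j => ?_⟩, h.2, hw⟩
    · simpa using v_apply_le_of_mulVec_anisoVec_eq σ hJ hd hw i j
    · have := v_apply_le_of_mulVec_anisoVec_eq σ hJ hd hw' i j
      rw [Subgroup.coe_inv] at this
      simpa using this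

end Stabilizer

/-! ## §2 Type (2): `1` is not an eigenvalue of `t ∈ Stab(w₀)` off the line `K w₀` -/

section Eigen

omit [Valued K ℤᵐ⁰] in
/-- If `t = M(b_t,q_t,r_t,s_t)` fixes `x` and `q_t r_t − b_t(s_t − 1) ≠ 0` then `x ∈ K w₀`: with `y = 2ϖx₀ + x₂`, `t x = x` reads `b_t y + q_t x₁ = 0`, `r_t y + (s_t − 1)x₁ = 0`.
[cite: Flicker1998UnitaryFL, Prop. 16 p. 96] -/
theorem mulVec_eq_self_of_det_ne_zero (ϖ : K) {bt qt rt st : K} (hne : qt * rt - bt * (st - 1) ≠ 0) {x : Fin 3 → K}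
    (hx : (!![1 + 2 * ϖ * bt, qt, bt; 2 * ϖ * rt, st, rt; 4 * ϖ ^ 2 * bt, 2 * ϖ * qt, 1 + 2 * ϖ * bt] : Matrix (Fin 3) (Fin 3) K) *ᵥ x = x) :
    x = x 0 • ![1, 0, -(2 * ϖ)] := by
  have e0 := congrFun hx 0
  have e1 := congrFun hx 1
  simp only [Matrix.mulVec, dotProduct, Fin.sum_univ_three, Matrix.of_apply, Matrix.cons_val', Matrix.cons_val_zero, Matrix.cons_val_one,
    Matrix.cons_val_two, Matrix.tail_cons, Matrix.head_cons, Matrix.empty_val', Matrix.cons_val_fin_one] at e0 e1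
  -- `y = 2ϖ x₀ + x₂`; the two linear equations
  have eq1 : bt * (2 * ϖ * x 0 + x 2) + qt * x 1 = 0 := by linear_combination e0
  have eq2 : rt * (2 * ϖ * x 0 + x 2) + (st - 1) * x 1 = 0 := by linear_combination e1
  have hx1 : x 1 = 0 := by
    have h : (qt * rt - bt * (st - 1)) * x 1 = 0 := by linear_combination rt * eq1 - bt * eq2
    exact (mul_eq_zero.1 h).resolve_left hne
  have hy : 2 * ϖ * x 0 + x 2 = 0 := by
    have h : (qt * rt - bt * (st - 1)) * (2 * ϖ * x 0 + x 2) = 0 := by linear_combination qt * eq2 - (st - 1) * eq1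
    exact (mul_eq_zero.1 h).resolve_left hne
  ext i
  fin_cases i
  · simp
  · simp [hx1]
  · simp only [Fin.reduceFinMk, Pi.smul_apply, Matrix.cons_val_two, Matrix.tail_cons, Matrix.head_cons, smul_eq_mul]
    linear_combination hy

include hJ in
/-- **The determinant `q_t r_t − b_t(s_t − 1)` is non-zero for a type-(2) element of `Stab(w₀)`** (`|q_t| = |r_t| = |ϖ|^N`, `|A_t − s_t| ≤ |ϖ|^{N+1}`): multiplying by `4ϖ`,
`4ϖq_tr_t` has ODD valuation exponent `2N+1` while `(A_t − 1)(s_t − 1)` has an EVEN one or is `≤ |ϖ|^{2N+2}`. [cite: Flicker1998UnitaryFL, Prop. 16 p. 96] -/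
theorem det_typeTwo_ne_zero (hd : LocalConjDatum σ ϖ) {t : ↥(unitaryGroupOfForm σ J)} {bt qt rt st : K}
    (htc : ((t : GL (Fin 3) K) : Matrix (Fin 3) (Fin 3) K) = !![1 + 2 * ϖ * bt, qt, bt; 2 * ϖ * rt, st, rt; 4 * ϖ ^ 2 * bt, 2 * ϖ * qt, 1 + 2 * ϖ * bt])
    (N : ℕ) (hqt : Valued.v qt = WithZero.exp (-(N : ℤ))) (hrt : Valued.v rt = WithZero.exp (-(N : ℤ)))
    (hAst : Valued.v ((1 + 4 * ϖ * bt) - st) ≤ WithZero.exp (-((N : ℤ) + 1))) :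
    qt * rt - bt * (st - 1) ≠ 0 := by
  obtain ⟨hst1, -, hAt, -⟩ := stabilizer_valuation_bounds σ hJ hd htc
  have h4 : Valued.v (4 : K) = 1 := by rw [show (4 : K) = 2 * 2 by norm_num, map_mul, hd.v2, one_mul]
  intro h0
  -- `4ϖ·det = 4ϖ q_t r_t − (A_t − 1)(s_t − 1)`
  have hkey : 4 * ϖ * (qt * rt) = ((1 + 4 * ϖ * bt) - 1) * (st - 1) := by linear_combination (4 * ϖ) * h0
  have hv1 : Valued.v (4 * ϖ * (qt * rt)) = WithZero.exp (-(2 * (N : ℤ) + 1)) := by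
    rw [map_mul, map_mul, h4, one_mul, hd.vϖ, map_mul, hqt, hrt, ← WithZero.exp_add, ← WithZero.exp_add]; congr 1; ring
  rw [hkey, map_mul] at hv1
  -- parity∕size contradiction
  by_cases hsmall : Valued.v ((1 + 4 * ϖ * bt) - 1) ≤ WithZero.exp (-((N : ℤ) + 1))
  · have hs1 : Valued.v (st - 1) ≤ WithZero.exp (-((N : ℤ) + 1)) := by
      rw [show st - 1 = ((1 + 4 * ϖ * bt) - 1) - ((1 + 4 * ϖ * bt) - st) by ring]
      exact Valuation.map_sub_le _ hsmall hAst
    have h := mul_le_mul' hsmall hs1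
    rw [hv1, ← WithZero.exp_add, WithZero.exp_le_exp] at h
    omega
  · -- `|A_t − 1| > |ϖ|^{N+1} ≥ |A_t − s_t|` ⇒ `|s_t − 1| = |A_t − 1|` ⇒ the product is a square
    rw [not_le] at hsmall
    have hs1 : Valued.v (st - 1) = Valued.v ((1 + 4 * ϖ * bt) - 1) := by
      rw [show st - 1 = ((1 + 4 * ϖ * bt) - 1) + -((1 + 4 * ϖ * bt) - st) by ring]
      exact Valuation.map_add_eq_of_lt_left _ (by rw [Valuation.map_neg]; exact hAst.trans_lt hsmall)
    rw [hs1] at hv1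
    have hne0 : Valued.v ((1 + 4 * ϖ * bt) - 1) ≠ 0 := fun h => by
      rw [h, mul_zero] at hv1; exact WithZero.zero_ne_coe hv1
    obtain ⟨e, he⟩ : ∃ e : ℤ, Valued.v ((1 + 4 * ϖ * bt) - 1) = WithZero.exp e := ⟨_, (WithZero.exp_log hne0).symm⟩
    rw [he, ← WithZero.exp_add] at hv1
    have := WithZero.exp_injective hv1
    omega

end Eigen

/-! ## §3 The centraliser of a type-(2) element of `Stab(w₀)` is compact -/

section Centralizer

include hJ in
/-- **Centraliser elements are bounded**: for `t ∈ U` with `t w₀ = w₀` and the shape determinant non-zero, every `z ∈ U` commuting with `t` has all entries of valuation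
`≤ exp 1` — `z w₀` is again fixed by `t`, so `z w₀ = c w₀`; `σc·c = 1` (★ `map_mul_self_eq_one_of_mulVec_eq_smul`); `c⁻¹·z ∈ Stab(w₀)` (★ `exists_coe_eq_smul_one`) is
bounded by §1. [cite: Flicker1998UnitaryFL, Prop. 4 p. 82, Prop. 16 p. 96] [cite: Rogawski1990, §3.6] -/
theorem v_apply_le_of_commute_of_mem_stabilizer (hd : LocalConjDatum σ ϖ) {t : ↥(unitaryGroupOfForm σ J)} {bt qt rt st : K}
    (htc : ((t : GL (Fin 3) K) : Matrix (Fin 3) (Fin 3) K) = !![1 + 2 * ϖ * bt, qt, bt; 2 * ϖ * rt, st, rt; 4 * ϖ ^ 2 * bt, 2 * ϖ * qt, 1 + 2 * ϖ * bt])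
    (hne : qt * rt - bt * (st - 1) ≠ 0) {z : ↥(unitaryGroupOfForm σ J)} (hz : z * t = t * z) (i j : Fin 3) :
    Valued.v (((z : GL (Fin 3) K) : Matrix (Fin 3) (Fin 3) K) i j) ≤ WithZero.exp (1 : ℤ) := by
  set w₀ : Fin 3 → K := ![1, 0, -(2 * ϖ)] with hw₀
  have hϖ0 : ϖ ≠ 0 := hd.ϖ_ne_zero
  -- `t (z w₀) = z w₀`
  have htw : ((t : GL (Fin 3) K) : Matrix (Fin 3) (Fin 3) K) *ᵥ w₀ = w₀ := by rw [htc, hw₀]; exact shape_mulVec_anisoVec ϖ bt qt rt st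
  have hcomm : ((z : GL (Fin 3) K) : Matrix (Fin 3) (Fin 3) K) * ((t : GL (Fin 3) K) : Matrix (Fin 3) (Fin 3) K) =
      ((t : GL (Fin 3) K) : Matrix (Fin 3) (Fin 3) K) * ((z : GL (Fin 3) K) : Matrix (Fin 3) (Fin 3) K) := by
    have := congrArg (fun y : ↥(unitaryGroupOfForm σ J) => ((y : GL (Fin 3) K) : Matrix (Fin 3) (Fin 3) K)) hz
    simpa only [Subgroup.coe_mul, Units.val_mul] using this
  have hfix : ((t : GL (Fin 3) K) : Matrix (Fin 3) (Fin 3) K) *ᵥ (((z : GL (Fin 3) K) : Matrix (Fin 3) (Fin 3) K) *ᵥ w₀) =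
      ((z : GL (Fin 3) K) : Matrix (Fin 3) (Fin 3) K) *ᵥ w₀ := by
    rw [Matrix.mulVec_mulVec, ← hcomm, ← Matrix.mulVec_mulVec, htw]
  rw [htc] at hfix
  -- so `z w₀ = c w₀`
  have hzw := mulVec_eq_self_of_det_ne_zero ϖ hne hfix
  set c : K := (((z : GL (Fin 3) K) : Matrix (Fin 3) (Fin 3) K) *ᵥ w₀) 0 with hc
  rw [← hw₀] at hzw
  -- `σc c = 1`
  have hB : B₀ σ 3 w₀ w₀ ≠ 0 := by
    rw [hw₀, B₀_apply]
    simp [Fin.sum_univ_three, map_neg, map_mul, map_ofNat, hd.σϖ]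
    intro h
    have : (4 : K) * ϖ = 0 := by linear_combination -h
    have h20 : (2 : K) ≠ 0 := fun h0 => by have := hd.v2; rw [h0, map_zero] at this; exact zero_ne_one this
    exact mul_ne_zero (by rw [show (4 : K) = 2 * 2 by norm_num]; exact mul_ne_zero h20 h20) hϖ0 this
  have hcn : σ c * c = 1 := map_mul_self_eq_one_of_mulVec_eq_smul σ hJ z hzw hB
  have hc0 : c ≠ 0 := fun h0 => by rw [h0, mul_zero] at hcn; exact zero_ne_one hcn
  have hvc : Valued.v c = 1 := by
    have h := congrArg (fun x : K => Valued.v x) hcn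
    simp only [map_mul, hd.vσ, map_one] at h
    exact Literature.NumberTheory.QuadraticForms.OMeara65.WithZeroMulInt.eq_one_of_mul_self h
  -- `c⁻¹ z ∈ Stab(w₀)`
  have hcn' : σ c⁻¹ * c⁻¹ = 1 := by rw [map_inv₀, ← mul_inv, hcn, inv_one]
  obtain ⟨zc, hzc, -, -⟩ := exists_coe_eq_smul_one σ hJ hd hcn'
  have hy : (((zc * z : ↥(unitaryGroupOfForm σ J)) : GL (Fin 3) K) : Matrix (Fin 3) (Fin 3) K) = c⁻¹ • ((z : GL (Fin 3) K) : Matrix (Fin 3) (Fin 3) K) := by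
    rw [Subgroup.coe_mul, Units.val_mul, hzc, Matrix.smul_mul, Matrix.one_mul]
  have hyw : (((zc * z : ↥(unitaryGroupOfForm σ J)) : GL (Fin 3) K) : Matrix (Fin 3) (Fin 3) K) *ᵥ w₀ = w₀ := by
    rw [hy, Matrix.smul_mulVec, hzw, smul_smul, inv_mul_cancel₀ hc0, one_smul]
  have hbound := v_apply_le_of_mulVec_anisoVec_eq σ hJ hd hyw i j
  rw [hy, Matrix.smul_apply, smul_eq_mul, map_mul, map_inv₀, hvc, inv_one, one_mul] at hbound
  exact hbound

include hJ in
/-- **THE CENTRALISER OF A TYPE-(2) ELEMENT OF `Stab(w₀)` IS COMPACT** (compact valuation ring): for `t ∈ U` of the stabiliser shape with `q_t r_t − b_t(s_t − 1) ≠ 0`,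
`Z_U(t)` is closed and every `z ∈ Z_U(t)` (with `z⁻¹ ∈ Z_U(t)`) has entries of valuation `≤ exp 1`, so `Z_U(t)` lies in the compact box ★ `isCompact_setOf_v_apply_le_exp`.
[cite: Rogawski1990, §3.6 pp. 31–32] [cite: PlatonovRapinchuk1994, §3.1 Thm. 3.1] -/
theorem compactSpace_centralizer_of_mem_stabilizer [CompactSpace 𝒪[K]] (hd : LocalConjDatum σ ϖ) {t : ↥(unitaryGroupOfForm σ J)} {bt qt rt st : K}
    (htc : ((t : GL (Fin 3) K) : Matrix (Fin 3) (Fin 3) K) = !![1 + 2 * ϖ * bt, qt, bt; 2 * ϖ * rt, st, rt; 4 * ϖ ^ 2 * bt, 2 * ϖ * qt, 1 + 2 * ϖ * bt])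
    (hne : qt * rt - bt * (st - 1) ≠ 0) :
    CompactSpace ↥(Subgroup.centralizer ({t} : Set ↥(unitaryGroupOfForm σ J))) := by
  have hσc : Continuous σ := continuous_of_forall_v_eq hd.vσ
  have hUc : IsClosed ((unitaryGroupOfForm σ J : Subgroup (GL (Fin 3) K)) : Set (GL (Fin 3) K)) := isClosed_unitaryGroupOfForm hσc J
  have hbox := isCompact_setOf_v_apply_le_exp (n := Fin 3) hd.vϖ 1
  have hemb : Topology.IsClosedEmbedding (Subtype.val : ↥(unitaryGroupOfForm σ J) → GL (Fin 3) K) := hUc.isClosedEmbedding_subtypeVal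
  -- the centraliser is closed in `↥U`
  have hZc : IsClosed ((Subgroup.centralizer ({t} : Set ↥(unitaryGroupOfForm σ J)) : Subgroup ↥(unitaryGroupOfForm σ J)) : Set ↥(unitaryGroupOfForm σ J)) := by
    have : ((Subgroup.centralizer ({t} : Set ↥(unitaryGroupOfForm σ J)) : Subgroup ↥(unitaryGroupOfForm σ J)) : Set ↥(unitaryGroupOfForm σ J)) =
        {z : ↥(unitaryGroupOfForm σ J) | z * t = t * z} := by
      ext z; exact Subgroup.mem_centralizer_singleton_iff
    rw [this]
    exact isClosed_eq (continuous_id.mul continuous_const) (continuous_const.mul continuous_id)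
  -- and contained in the pull-back of the compact box
  have hsub : ((Subgroup.centralizer ({t} : Set ↥(unitaryGroupOfForm σ J)) : Subgroup ↥(unitaryGroupOfForm σ J)) : Set ↥(unitaryGroupOfForm σ J)) ⊆
      Subtype.val ⁻¹' {g : GL (Fin 3) K | (∀ i j, Valued.v ((g : Matrix (Fin 3) (Fin 3) K) i j) ≤ WithZero.exp ((1 : ℕ) : ℤ)) ∧
        ∀ i j, Valued.v (((g⁻¹ : GL (Fin 3) K) : Matrix (Fin 3) (Fin 3) K) i j) ≤ WithZero.exp ((1 : ℕ) : ℤ)} := by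
    intro z hz
    have hz' : z * t = t * z := Subgroup.mem_centralizer_singleton_iff.1 hz
    have hzi : z⁻¹ * t = t * z⁻¹ := by
      calc z⁻¹ * t = z⁻¹ * (t * z) * z⁻¹ := by group
        _ = z⁻¹ * (z * t) * z⁻¹ := by rw [hz']
        _ = t * z⁻¹ := by group
    refine ⟨fun i j => ?_, fun i j => ?_⟩
    · simpa using v_apply_le_of_commute_of_mem_stabilizer σ hJ hd htc hne hz' i j
    · have := v_apply_le_of_commute_of_mem_stabilizer σ hJ hd htc hne hzi i j
      rw [Subgroup.coe_inv] at this
      simpa using this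
  exact isCompact_iff_compactSpace.1 ((hemb.isCompact_preimage hbox).of_isClosed_subset hZc hsub)

include hJ in
/-- **(E4″) in the ★ (ii-b)∕(iii-a) sizes**: for `t ∈ Stab(w₀)` with `|q_t| = |r_t| = |ϖ|^N`, `|A_t − s_t| ≤ |ϖ|^{N+1}` (type (2), exponent `N`), `Z_U(t)` is compact.
[cite: Rogawski1990, §3.6 pp. 31–32] [cite: Flicker1998UnitaryFL, Prop. 16 p. 96] -/
theorem compactSpace_centralizer_of_mem_stabilizer_of_typeTwo [CompactSpace 𝒪[K]] (hd : LocalConjDatum σ ϖ) {t : ↥(unitaryGroupOfForm σ J)} {bt qt rt st : K}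
    (htc : ((t : GL (Fin 3) K) : Matrix (Fin 3) (Fin 3) K) = !![1 + 2 * ϖ * bt, qt, bt; 2 * ϖ * rt, st, rt; 4 * ϖ ^ 2 * bt, 2 * ϖ * qt, 1 + 2 * ϖ * bt])
    (N : ℕ) (hqt : Valued.v qt = WithZero.exp (-(N : ℤ))) (hrt : Valued.v rt = WithZero.exp (-(N : ℤ)))
    (hAst : Valued.v ((1 + 4 * ϖ * bt) - st) ≤ WithZero.exp (-((N : ℤ) + 1))) :
    CompactSpace ↥(Subgroup.centralizer ({t} : Set ↥(unitaryGroupOfForm σ J))) :=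
  compactSpace_centralizer_of_mem_stabilizer σ hJ hd htc (det_typeTwo_ne_zero σ hJ hd htc N hqt hrt hAst)

end Centralizer

/-! ## §4 Transports of `CompactSpace Z({x})`: central factors, conjugation, topological group isomorphisms -/

section Transport

variable {G H : Type*} [Group G] [TopologicalSpace G] [Group H] [TopologicalSpace H]

omit [TopologicalSpace G] in
/-- A CENTRAL factor does not change the centraliser: `Z({z·y}) = Z({y})` when `z` commutes with everything (the central unit `u·1` of the κ = −1 normal form).
[cite: Flicker1998UnitaryFL, Prop. 16 p. 96] [cite: Rogawski1990, §3.6 p. 31] -/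
theorem centralizer_singleton_mul_eq_of_forall_commute {z : G} (hz : ∀ g : G, z * g = g * z) (y : G) :
    Subgroup.centralizer ({z * y} : Set G) = Subgroup.centralizer ({y} : Set G) := by
  ext g
  rw [Subgroup.mem_centralizer_singleton_iff, Subgroup.mem_centralizer_singleton_iff]
  constructor
  · intro h
    have h1 : z * (g * y) = z * (y * g) := by
      calc z * (g * y) = (z * g) * y := by group
        _ = (g * z) * y := by rw [hz g]
        _ = g * (z * y) := by group
        _ = z * y * g := h
        _ = z * (y * g) := by group
    exact mul_left_cancel h1
  · intro h
    calc g * (z * y) = (g * z) * y := by group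
      _ = (z * g) * y := by rw [hz g]
      _ = z * (g * y) := by group
      _ = z * (y * g) := by rw [h]
      _ = z * y * g := by group

/-- **Compactness of centralisers along a topological group isomorphism**: `Z({e x}) ≃ₜ Z({x})` (the frame step `U(H′)(L⁺_v) ≃ₜ* U(σ_w, Φ₃)(L_w)`).
[cite: PlatonovRapinchuk1994, §3.1 Thm. 3.1] [cite: Rogawski1990, §3.6 pp. 31–32] -/
theorem compactSpace_centralizer_of_continuousMulEquiv (e : G ≃ₜ* H) (x : G)
    [hc : CompactSpace ↥(Subgroup.centralizer ({e x} : Set H))] : CompactSpace ↥(Subgroup.centralizer ({x} : Set G)) := by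
  have hiff : ∀ g : G, g ∈ Subgroup.centralizer ({x} : Set G) ↔ e g ∈ Subgroup.centralizer ({e x} : Set H) := fun g => by
    rw [Subgroup.mem_centralizer_singleton_iff, Subgroup.mem_centralizer_singleton_iff, ← map_mul, ← map_mul, e.injective.eq_iff]
  exact ((e.toHomeomorph.subtype hiff).symm).compactSpace

/-- **Compactness of centralisers is conjugation-invariant**: `CompactSpace Z({g y g⁻¹}) ↔ CompactSpace Z({y})` (`Z(g y g⁻¹) = g Z(y) g⁻¹`).
[cite: PlatonovRapinchuk1994, §3.1 Thm. 3.1] [cite: Rogawski1990, §3.6 pp. 31–32] -/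
theorem compactSpace_centralizer_conj_iff [IsTopologicalGroup G] (g y : G) :
    CompactSpace ↥(Subgroup.centralizer ({g * y * g⁻¹} : Set G)) ↔ CompactSpace ↥(Subgroup.centralizer ({y} : Set G)) := by
  let e : G ≃ₜ* G :=
    { MulAut.conj g with
      continuous_toFun := (continuous_const.mul continuous_id).mul continuous_const
      continuous_invFun := (continuous_const.mul continuous_id).mul continuous_const }
  have he : e y = g * y * g⁻¹ := rfl
  constructor
  · intro h
    rw [← he] at h
    exact compactSpace_centralizer_of_continuousMulEquiv e y
  · intro h
    have he' : e.symm (g * y * g⁻¹) = y := by rw [← he, ContinuousMulEquiv.symm_apply_apply]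
    haveI : CompactSpace ↥(Subgroup.centralizer ({e.symm (g * y * g⁻¹)} : Set G)) := by rw [he']; exact h
    exact compactSpace_centralizer_of_continuousMulEquiv e.symm (g * y * g⁻¹)

end Transport

end UnitaryGroup

end Literature.NumberTheory.Automorphic

end
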